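import Mathlib
import HarnessLib
import Summits.HubbardSuperconductivity.HubbardSuperconductivity.Theorems.KLProgrammeKLRegimeEngineTowerModelDefs
import Summits.HubbardSuperconductivity.HubbardSuperconductivity.Theorems.KLProgrammeKLRegimeEngineThinCountDoors
import Literature.MathematicalPhysics.QuantumLattice.SectorisedKernelNormCount

/-!
# Route `KLProgramme` — crux K3 ENGINE (stmt-HubbardSuperconductivity-20437 `KLRegimeEngineV17F2`), stub (b) v2 (ℓ), import (I4) at four legs:
# THE SECTOR-COUNTING HALF OF `μ k 2 ≤ ι₂·λ` — the levelled measured quartic size from an ANISOTROPIC all-fixed four-leg line and the anchored count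
# (cell gate-hubbard-kl, seat hubbard-kl-k3c2-p3 g9, «S3 → W3»; memo P2-IMPORT.md: the CONDITIONAL conversion — the line itself is the open input)

WHAT.  BGM's endpoint treatment of a four-leg vertex in the sector bookkeeping (§2.7 (2.71), §2.8 (2.96)): the one-prescribed (levelled) sectorised
size is at most (the anchored anisotropic sector count) × (the `L¹` size of the kernel with ALL FOUR anisotropic sectors fixed).  For the levels
tower ((ℓ), E1-LEVELS-BLUEPRINT §3 (I4)) the measured input datum of degree `4` is `klTowerMeasLev L M β U μ K d k 4 F` = the supremum over prescriptions
`Ωe` of level-count `F` of `klLevNormOf L M β μ K (dk−1) 4 (𝒱_{dk}[K]) Ωe` (…EngineTowerModelDefs).  This file proves, for ANY Grassmann element `T`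
and family scale `J`:

* §1 `klLevNormOf_four_le_card_mul`: if every anchored count `#{Ω ∈ bgmSectorSet (F_J) 4 : Ω_p = s} ≤ N_c` and every compatible tuple's pinned `L¹` size
  (any leg pinned anywhere) is `≤ Bₐ`, then `klLevNormOf L M β μ K J 4 T Ωe ≤ N_c·Bₐ` for EVERY prescription `Ωe` (a prescription only drops tuples);
* §2 `klLevNormOf_four_le_thinCount_mul`: the same with p4's log-free anchored count UNDER THE NAMED DOORS
  (`card_bgmSectorSet_klAniso_anchored_le_doors`: `N_c = klThinCountC · sectorCount J`);
* §3 `klTowerMeasLev_four_le_thinCount_mul`: the tower instance `T = 𝒱_{dk}[K]`, `J = dk − 1`: `klTowerMeasLev … d k 4 F ≤ klThinCountC · sectorCount (dk−1) · Bₐ`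
  for every level-count `F` — in the kit's b-units (`2^{dk}` for four legs) this is `ι₂·λ = klThinCountC · Bₐ · sectorCount(dk−1)/2^{dk} = klThinCountC · Bₐ`.
WHAT IS NOT HERE (memo P2-IMPORT): the anisotropic all-fixed line `Bₐ` itself (BGM (2.71a) proper; the DROPPED second clause of `EndpointNormLine`); it is
NOT a consequence of the isotropic line `IsoTupleL1AtV17F` by counting (loss `4^{J}`), and it has no producer in `HistP klPredsV17F2` / class #1 today.
Inequalities with explicit hypotheses; nothing about the model is asserted; nothing asserts superconductivity.
References: BGM 2006 §2.7 (2.71)/(2.71a), §2.8 (2.76)–(2.77), (2.96), App. A3 Lemma A3.1 [cite: BenfattoGiulianiMastropietro2006].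
-/

noncomputable section

namespace Summit.HubbardSuperconductivity.HubbardSuperconductivity.Theorems.EngineV8

set_option linter.dupNamespace false -- summit = problem name (single-conjunct summit), D-0017

open Real Finset Literature.MathematicalPhysics.QuantumLattice Literature.Probability.LatticeModels
open Literature.MathematicalPhysics.QuantumLattice.FermiRG
open Summit.HubbardSuperconductivity.HubbardSuperconductivity.Theorems.KLRegimeSplit
open Summit.HubbardSuperconductivity.HubbardSuperconductivity.Theorems.KLProgrammeLegKernels
open Summit.HubbardSuperconductivity.HubbardSuperconductivity.Theorems.DispersionFlow

variable {L M : ℕ} [NeZero L]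

/-! ## §1 Count × all-fixed size, any prescription -/

/-- **ONE-PRESCRIBED (LEVELLED) FOUR-LEG SIZE ≤ ANCHORED COUNT × ALL-FIXED SIZE** (`0 ≤ β`; any `T`, family scale `J`, prescription `Ωe`): if every anchored
count of compatible anisotropic 4-tuples is `≤ N_c` and every compatible tuple's pinned `L¹` size — `ε³·Σ_{X : X p = x} ‖W^{F_J}_{4,Ω}(T)(X)‖`, any leg `p` pinned at
any `x` — is `≤ Bₐ`, then `klLevNormOf L M β μ K J 4 T Ωe ≤ N_c · Bₐ`. [cite: BenfattoGiulianiMastropietro2006, §2.8 (2.76)-(2.77) and (2.96)] -/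
theorem klLevNormOf_four_le_card_mul {β : ℝ} (hβ : 0 ≤ β) (μ : ℝ) (K : TrigPolyC4v) (J : ℕ) (T : HubbardGrassmann L M)
    (Ωe : Fin 4 → Option (SectorLeg (sectorCount J))) {Nc Bₐ : ℝ} (hNc : 0 ≤ Nc) (hB : 0 ≤ Bₐ)
    (hcount : ∀ (p : Fin 4) (s : SectorLeg (sectorCount J)),
      ((((bgmSectorSet L M (klAnisoFamily L M β μ K klE0 J) 4).filter
        (fun Ω : Fin 4 → SectorLeg (sectorCount J) => Ω p = s)).card : ℕ) : ℝ) ≤ Nc)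
    (hline : ∀ Ω ∈ bgmSectorSet L M (klAnisoFamily L M β μ K klE0 J) 4, ∀ (p : Fin 4) (x : SpaceTimeIdx L M),
      imagTimeWeight β M ^ 3 * ∑ X ∈ univ.filter (fun X : Fin 4 → SpaceTimeIdx L M => X p = x),
        ‖sectorisedKernel L M β (klAnisoFamily L M β μ K klE0 J) T 4 Ω X‖ ≤ Bₐ) :
    klLevNormOf L M β μ K J 4 T Ωe ≤ Nc * Bₐ := by
  unfold klLevNormOf
  rw [hubbardSectorKernelNorm_def]
  refine (sectorisedKernelNorm_mono_set (imagTimeWeight_nonneg hβ M) (prescribedTuples_subset _ _) _).trans ?_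
  exact sectorisedKernelNorm_le_card_mul (imagTimeWeight β M) (m := 3) _ _ hNc hB hcount hline

/-! ## §2 Under p4's doors -/

/-- **THE SAME UNDER THE NAMED DOORS OF THE ANCHORED COUNT** (`card_bgmSectorSet_klAniso_anchored_le_doors`): for `R` with `0 ≤ R.Gfr j`, `0 < c ≤ klThinCountC₃ R`,
`0 < U ≤ klThinCountU₀ R`, `klBetaMin ≤ β ≤ e^{c/U²}`, `μ ∈ klWindowC`, an admissible frame `FrameOK R U (nScales β) ν K`, any `T`, `J`, `Ωe`, and an all-fixed
anisotropic line `Bₐ ≥ 0` as in §1: `klLevNormOf L M β μ K J 4 T Ωe ≤ klThinCountC · sectorCount J · Bₐ`.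
[cite: BenfattoGiulianiMastropietro2006, §2.7 (2.71a), §2.8 (2.96)] -/
theorem klLevNormOf_four_le_thinCount_mul {R : RenConsts} (hR : ∀ j, 0 ≤ R.Gfr j) {c : ℝ} (hc : 0 < c) (hc₃ : c ≤ klThinCountC₃ R)
    {U : ℝ} (hU : 0 < U) (hU₀ : U ≤ klThinCountU₀ R) {β : ℝ} (hβ : klBetaMin ≤ β) (hβc : β ≤ Real.exp (c / U ^ 2)) {μ : ℝ} (hμ : μ ∈ klWindowC)
    (ν : ℝ) {K : TrigPolyC4v} (hK : FrameOK R U (nScales β) ν K) (J : ℕ) (T : HubbardGrassmann L M)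
    (Ωe : Fin 4 → Option (SectorLeg (sectorCount J))) {Bₐ : ℝ} (hB : 0 ≤ Bₐ)
    (hline : ∀ Ω ∈ bgmSectorSet L M (klAnisoFamily L M β μ K klE0 J) 4, ∀ (p : Fin 4) (x : SpaceTimeIdx L M),
      imagTimeWeight β M ^ 3 * ∑ X ∈ univ.filter (fun X : Fin 4 → SpaceTimeIdx L M => X p = x),
        ‖sectorisedKernel L M β (klAnisoFamily L M β μ K klE0 J) T 4 Ω X‖ ≤ Bₐ) :
    klLevNormOf L M β μ K J 4 T Ωe ≤ klThinCountC * sectorCount J * Bₐ := by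
  have hβ0 : 0 ≤ β := le_trans (by norm_num [klBetaMin]) hβ
  have hNc : 0 ≤ klThinCountC * (sectorCount J : ℝ) := mul_nonneg klThinCountC_pos.le (Nat.cast_nonneg _)
  exact klLevNormOf_four_le_card_mul hβ0 μ K J T Ωe hNc hB
    (fun p s => card_bgmSectorSet_klAniso_anchored_le_doors hR hc hc₃ hU hU₀ hβ hβc hμ ν hK L M J p s) hline

/-! ## §3 The tower instance: the measured levelled quartic size of block `k` -/

/-- **(I4) AT FOUR LEGS, LEVELLED TRACK, CONDITIONAL FORM**: under the doors of §2, if the four-leg kernel of the block input `𝒱_{dk}[K]` sectorised with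
`F_{dk−1}` has all-fixed anisotropic pinned `L¹` sizes `≤ Bₐ` (every compatible tuple, any leg pinned anywhere), then for every level-count `F`
`klTowerMeasLev L M β U μ K d k 4 F ≤ klThinCountC · sectorCount (dk−1) · Bₐ` — i.e. `ι₂·λ = klThinCountC·Bₐ` in the kit's four-leg units.
[cite: BenfattoGiulianiMastropietro2006, §2.7 (2.71a), §2.8 (2.96)] -/
theorem klTowerMeasLev_four_le_thinCount_mul [NeZero M] {R : RenConsts} (hR : ∀ j, 0 ≤ R.Gfr j) {c : ℝ} (hc : 0 < c) (hc₃ : c ≤ klThinCountC₃ R)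
    {U : ℝ} (hU : 0 < U) (hU₀ : U ≤ klThinCountU₀ R) {β : ℝ} (hβ : klBetaMin ≤ β) (hβc : β ≤ Real.exp (c / U ^ 2)) {μ : ℝ} (hμ : μ ∈ klWindowC)
    (ν : ℝ) {K : TrigPolyC4v} (hK : FrameOK R U (nScales β) ν K) (d k F : ℕ) {Bₐ : ℝ} (hB : 0 ≤ Bₐ)
    (hline : ∀ Ω ∈ bgmSectorSet L M (klAnisoFamily L M β μ K klE0 (d * k - 1)) 4, ∀ (p : Fin 4) (x : SpaceTimeIdx L M),
      imagTimeWeight β M ^ 3 * ∑ X ∈ univ.filter (fun X : Fin 4 → SpaceTimeIdx L M => X p = x),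
        ‖sectorisedKernel L M β (klAnisoFamily L M β μ K klE0 (d * k - 1)) (klTowerInput L M β U μ K d k) 4 Ω X‖ ≤ Bₐ) :
    klTowerMeasLev L M β U μ K d k 4 F ≤ klThinCountC * sectorCount (d * k - 1) * Bₐ := by
  unfold klTowerMeasLev
  have hbound : 0 ≤ klThinCountC * (sectorCount (d * k - 1) : ℝ) * Bₐ :=
    mul_nonneg (mul_nonneg klThinCountC_pos.le (Nat.cast_nonneg _)) hB
  refine Real.iSup_le (fun Ωe => ?_) hbound
  exact klLevNormOf_four_le_thinCount_mul hR hc hc₃ hU hU₀ hβ hβc hμ ν hK (d * k - 1) _ Ωe.1 hB hline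

end Summit.HubbardSuperconductivity.HubbardSuperconductivity.Theorems.EngineV8

end
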